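import Summits.PneNP.PneNP.Statement
import Literature.Computability.Complexity.ConstantDepth
import Literature.Computability.Complexity.ACRealizeOver
import Literature.Computability.MetaComplexity.MCSP
import Literature.Computability.MetaComplexity.MCSPProofs
import HarnessLib

/-!
# Reach machinery for `RootDecompMcspReach` (helper for stmt-PneNP-32190 / 32191)

Node N41 of the decomp-pnenp root-decomposition cell (route `route-PneNP-RootDecompMcspReach`, lens-3 g9
«McspReachDial») cuts the root at the absolute notch «PARITY reduces to exact MCSP under NON-UNIFORM
constant-depth `acBasis` many-one reductions».  THIS FILE ports, with the lens's Prop-valued shorthands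
(`CDP`, `CDRed`, `HasTwin`, `ReachHard`) UNFOLDED IN PLACE so that no statement is vendored, the two
kernel facts the route's decided asides rest on: (1) the CLOSURE LAW — constant-depth polynomial-size
classes `{L | ∃ d p, L ∈ DepthSizeClass B d p}` are closed downward under non-uniform constant-depth
`B`-reductions (compose: depth `d′ + d`, size `p′(r n) + r n · p n`, via the tree's `ACRealOver.comp`);
(2) the BOTTOM END — over any basis `⊇ acBasis` every such language reduces to every language with a
TWIN PAIR (a yes- and a no-instance of equal length: map `x ↦ y₁ / y₀` by the indicator), and `MCSP` has
a twin pair (`n = 1`, threshold `0`: the projection has size `0`, its negation size `≥ 1`).  Verbatim from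
HOME/decomp-pnenp-lens-3/McspReachDial.lean sha256 57a43fb1… (critic CLEARED 09:50:01Z; anchor
HOME/critic/Anchor_N41_McspReach.lean 853e7a7e).  Route-independent (imports no Theses file).  0 sorry.
[cite: Vollmer1999, §1.4] [cite: AllenderHirahara2019]
-/

namespace Summit.PneNP.PneNP.Theorems.RootDecompMcspReachPort

open Literature.Computability.Complexity Literature.Computability.MetaComplexity

variable {B : Set GateFn} {L L' : Language Bool}

/-- Reading a list of length `m` through `getD` on `Fin m` is reading it through `get`. -/
theorem eval_getD_eq {m : ℕ} (C : CircuitFamily) (w : List Bool) (hw : w.length = m) :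
    (C m).eval (fun j : Fin m => w.getD j false) = (C w.length).eval w.get := by
  subst hw
  congr 1
  funext j
  simp

/-- A deciding family realizes the indicator of its language, length by length. -/
theorem acRealOver_indicator {d : ℕ} {p : Polynomial ℕ}
    (hL : L ∈ DepthSizeClass B (fun _ => d) (fun n => p.eval n)) (n : ℕ) :
    ACRealOver B (fun x : Fin n → Bool => Set.boolIndicator L (List.ofFn x)) d (p.eval n) := by
  obtain ⟨C, hC, hdec⟩ := hL
  have hdec' : ∀ y : List Bool, (C y.length).eval y.get = Set.boolIndicator L y := hdec
  refine (ACRealOver.of_circuit (C n) (hC n).1 (hC n).2.1 (hC n).2.2).congr fun x => ?_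
  have hw : (List.ofFn x).length = n := List.length_ofFn ..
  have hget : (fun j : Fin n => (List.ofFn x).getD j false) = x := by
    funext j
    simp
  rw [← hdec' (List.ofFn x), ← eval_getD_eq C _ hw, hget]


/-- **Closure law.** If `L ≤ L'` by `B`-reductions and `L' ∈ CDP B` then `L ∈ CDP B`
(compose: depth `d' + d`, size `p'(r n) + r n · p n`; `ACRealOver.comp`). -/
theorem mem_cdp_of_cdRed
    (h : ∃ (f : List Bool → List Bool) (r : Polynomial ℕ) (d : ℕ) (p : Polynomial ℕ),
      (∀ x, x ∈ L ↔ f x ∈ L') ∧ (∀ x, (f x).length = r.eval x.length) ∧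
      ∀ (n j : ℕ), j < r.eval n →
        ACRealOver B (fun x : Fin n → Bool => (f (List.ofFn x)).getD j false) d (p.eval n))
    (hL' : L' ∈ {L : Language Bool | ∃ d : ℕ, ∃ p : Polynomial ℕ, L ∈ DepthSizeClass B (fun _ => d) (fun n => p.eval n)}) :
    L ∈ {L : Language Bool | ∃ d : ℕ, ∃ p : Polynomial ℕ, L ∈ DepthSizeClass B (fun _ => d) (fun n => p.eval n)} := by
  classical
  obtain ⟨f, r, d, p, hred, hlen, hbits⟩ := h
  obtain ⟨d', p', hL'd⟩ := hL'
  obtain ⟨C', hC', hdec⟩ := hL'd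
  have hdec' : ∀ y : List Bool, (C' y.length).eval y.get = Set.boolIndicator L' y := hdec
  have key : ∀ n, ACRealOver B (fun x : Fin n → Bool => Set.boolIndicator L (List.ofFn x))
      (d' + d) (p'.eval (r.eval n) + r.eval n * p.eval n) := by
    intro n
    have hout : ACRealOver B (C' (r.eval n)).eval d' (p'.eval (r.eval n)) :=
      ACRealOver.of_circuit _ (hC' _).1 (hC' _).2.1 (hC' _).2.2
    have hin : ∀ j : Fin (r.eval n), ACRealOver B
        (fun x : Fin n → Bool => (f (List.ofFn x)).getD j false) d (p.eval n) :=
      fun j => hbits n j j.2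
    have hcomp := ACRealOver.comp hout hin
    simp only [Finset.sum_const, Finset.card_univ, Fintype.card_fin, smul_eq_mul] at hcomp
    refine hcomp.congr fun x => ?_
    have hw : (f (List.ofFn x)).length = r.eval n := by rw [hlen, List.length_ofFn]
    rw [eval_getD_eq C' _ hw, hdec' (f (List.ofFn x))]
    by_cases hx : List.ofFn x ∈ L
    · rw [(Set.mem_iff_boolIndicator L (List.ofFn x)).1 hx,
        (Set.mem_iff_boolIndicator L' (f (List.ofFn x))).1 ((hred _).1 hx)]
    · rw [(Set.notMem_iff_boolIndicator L (List.ofFn x)).1 hx,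
        (Set.notMem_iff_boolIndicator L' (f (List.ofFn x))).1 (fun h => hx ((hred _).2 h))]
  choose C hC using fun n => (key n).toCircuit
  refine ⟨d' + d, p'.comp r + r * p, C, fun n => ⟨(hC n).1, (hC n).2.1, ?_⟩, ?_⟩
  · simpa [Polynomial.eval_add, Polynomial.eval_mul, Polynomial.eval_comp] using (hC n).2.2.1
  · intro y
    have h : (C y.length).eval y.get = Set.boolIndicator L (List.ofFn y.get) :=
      (hC y.length).2.2.2 y.get
    rw [List.ofFn_get] at h
    exact h


/-- Selecting between two constant bits by a realized test costs one level and two gates. -/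
theorem acRealOver_cond (hB : acBasis ⊆ B) {n d s : ℕ} {e : (Fin n → Bool) → Bool}
    (he : ACRealOver B e d s) (a b : Bool) :
    ACRealOver B (fun x => cond (e x) a b) (d + 1) (s + 2) := by
  have hnot : GateFn.not ∈ B := hB mem_acBasis_not
  cases a <;> cases b
  · exact ((acRealOver_const hB false).mono (by omega) (by omega)).congr fun x => by
      cases e x <;> rfl
  · exact ((he.neg hnot).mono (by omega) (by omega)).congr fun x => by
      cases e x <;> rfl
  · exact (he.mono (by omega) (by omega)).congr fun x => by
      cases e x <;> rfl
  · exact ((acRealOver_const hB true).mono (by omega) (by omega)).congr fun x => by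
      cases e x <;> rfl


/-- **Bottom end.** Over any basis containing `acBasis`, every `CDP B` language reduces to every
language with a twin pair: map `x ↦ y₁` if `x ∈ L`, else `x ↦ y₀`; each output bit is a constant,
the indicator of `L`, or its negation. -/
theorem cdRed_of_mem_cdp (hB : acBasis ⊆ B)
    (hL : L ∈ {L : Language Bool | ∃ d : ℕ, ∃ p : Polynomial ℕ, L ∈ DepthSizeClass B (fun _ => d) (fun n => p.eval n)})
    (hT : ∃ y₁ y₀ : List Bool, y₁ ∈ L' ∧ y₀ ∉ L' ∧ y₀.length = y₁.length) :
    ∃ (f : List Bool → List Bool) (r : Polynomial ℕ) (d : ℕ) (p : Polynomial ℕ),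
      (∀ x, x ∈ L ↔ f x ∈ L') ∧ (∀ x, (f x).length = r.eval x.length) ∧
      ∀ (n j : ℕ), j < r.eval n →
        ACRealOver B (fun x : Fin n → Bool => (f (List.ofFn x)).getD j false) d (p.eval n) := by
  classical
  obtain ⟨d, pL, hLd⟩ := hL
  obtain ⟨y₁, y₀, hy₁, hy₀, hlen⟩ := hT
  refine ⟨fun x => if x ∈ L then y₁ else y₀, Polynomial.C y₁.length, d + 1, pL + Polynomial.C 2,
    ?_, ?_, ?_⟩
  · intro x
    by_cases hx : x ∈ L
    · simp only [if_pos hx]; exact ⟨fun _ => hy₁, fun _ => hx⟩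
    · simp only [if_neg hx]; exact ⟨fun h => (hx h).elim, fun h => (hy₀ h).elim⟩
  · intro x
    by_cases hx : x ∈ L
    · simp only [if_pos hx, Polynomial.eval_C]
    · simp only [if_neg hx, Polynomial.eval_C, hlen]
  · intro n j _hj
    have hind := acRealOver_indicator hLd n
    have hev : (pL + Polynomial.C 2).eval n = pL.eval n + 2 := by
      simp [Polynomial.eval_add]
    rw [hev]
    refine (acRealOver_cond hB hind (y₁.getD j false) (y₀.getD j false)).congr fun x => ?_
    by_cases hx : List.ofFn x ∈ L
    · rw [(Set.mem_iff_boolIndicator L (List.ofFn x)).1 hx]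
      simp only [if_pos hx, cond_true]
    · rw [(Set.notMem_iff_boolIndicator L (List.ofFn x)).1 hx]
      simp only [if_neg hx, cond_false]


/-- The identity circuit on one variable: no gates, output the input wire. -/
theorem input_computes_proj : (Circuit.input (0 : Fin 1)).Computes (fun x : Fin 1 → Bool => x 0) :=
  fun _ => rfl

/-- **MCSP has a twin pair** (n = 1, threshold s = 0): the projection `x ↦ x₀` has circuit size
`0` over `B2` (the gate-free circuit), its negation `x ↦ ¬x₀` has circuit size `≥ 1` (a size-0
circuit outputs an input wire, hence computes a projection); both instances
`⟨tt, encodeNat 0⟩` have the same length. -/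
theorem hasTwin_MCSP : ∃ y₁ y₀ : List Bool, y₁ ∈ MCSP ∧ y₀ ∉ MCSP ∧ y₀.length = y₁.length := by
  refine ⟨boolPair (truthTable fun x : Fin 1 → Bool => x 0) (Computability.encodeNat 0),
          boolPair (truthTable fun x : Fin 1 → Bool => !x 0) (Computability.encodeNat 0), ?_, ?_, by simp⟩
  · rw [boolPair_truthTable_mem_MCSP_iff]
    have h := circuitSizeOver_le_of_computes (B := B2) (Circuit.input (0 : Fin 1))
      (fun g hg => by simp [Circuit.input] at hg) input_computes_proj
    simpa [Circuit.size, Circuit.input] using h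
  · rw [boolPair_truthTable_mem_MCSP_iff, not_le]
    have hne : {s | ∃ C : Circuit (Fin 1), C.IsOver B2 ∧
        C.Computes (fun x : Fin 1 → Bool => !x 0) ∧ C.size = s}.Nonempty := by
      obtain ⟨C, hB2, -, -, hC⟩ := (acRealOver_notInput (B := B2) not_mem_B2 (0 : Fin 1)).toCircuit
      exact ⟨C.size, C, hB2, hC, rfl⟩
    obtain ⟨C, -, hC, hs⟩ := Nat.sInf_mem hne
    have hpos : 0 < C.size := by
      by_contra h0
      have hg : C.gates = [] := List.eq_nil_of_length_eq_zero (by unfold Circuit.size at h0; omega)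
      rcases hout : C.output with i | m
      · have h1 := hC fun _ => false
        simp [Circuit.eval, hout] at h1
      · have hm := C.wf_output m hout
        rw [hg] at hm
        exact Nat.not_lt_zero _ hm
    show 0 < sInf _
    rw [← hs]
    exact hpos

end Summit.PneNP.PneNP.Theorems.RootDecompMcspReachPort
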